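import Summits.ValiantsHypothesis.ValiantsHypothesis.Theorems.BlockLaplaceCircuit
import Literature.Computability.AlgebraicComplexity.ValiantCriterionCounting
import HarnessLib

/-!
# Boolean gadgets and the indicator polynomial of exact covers
(decomposition workshop `decomp-valiant`, lens 6 «restricted-models lifting axis», gen 3; support
kernel for the split of `DecompCycle1.TamePer` into the crux `PerNotSmVP`
(stmt-ValiantsHypothesis-23661) and the lifting residual `TameOrSmLift`
(stmt-ValiantsHypothesis-23662))

`XC_(c,m)` is the generating polynomial of the Boolean part of a small polynomial: with the
exactly-one gadget `EX1_A = ∑_(v∈A) X_v ∏_(w∈A∖v) (1 - X_w)`, the none gadget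
`NONE_A = ∏_(w∈A) (1 - X_w)` and `AM1_A = EX1_A + NONE_A` (Boolean values, sizes and degrees in
Part IV), the indicator polynomial `indPoly = (∏_b EX1_(block b)) · (∏_j AM1_(column j))` takes the
value `1` at a Boolean point exactly when the point is the indicator vector of a family of pairwise
disjoint `c`-sets, one per block, and `0` otherwise (`eval_boolPoint_indPoly`); hence its
generating polynomial is `XC_(c,m)` (`genPolyV_indPoly`; `genPoly_rename_equiv` transports the
tree's `Fin`-indexed `ValiantCriterion.genPoly`). [Bürgisser 2000, proof of Prop. 2.20.]

HONEST FRAMING: circuit bookkeeping of published constructions (block Laplace expansion,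
Limaye–Srinivasan–Tavenas Lemma 12, Valiant's criterion); nothing here bears on the truth of
`VP ≠ VNP`.

## References

* [Minc1978] H. Minc, *Permanents*, Addison–Wesley 1978, Ch. 2, Thm. 1.2 (Laplace expansion).
* [Burgisser2000] P. Bürgisser, *Completeness and Reduction in Algebraic Complexity Theory*,
  Springer 2000, Def. 2.1, Prop. 2.20, Rem. 2.2.
-/

noncomputable section

namespace Summit.ValiantsHypothesis.ValiantsHypothesis.Theorems.ExactCoverIndicator

open Finset Matrix Summit.ValiantsHypothesis.ValiantsHypothesis.Theorems.BlockLaplaceExpansion Summit.ValiantsHypothesis.ValiantsHypothesis.Theorems.BlockLaplaceCircuit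

/-! ## Part IV — Boolean gadgets: `XC_{c,m}` is the generating polynomial of the Boolean part of a
small product polynomial (Valiant's criterion, Bürgisser 2000, Prop. 2.20) -/

section Gadgets

open MvPolynomial Literature.Computability.AlgebraicComplexity

variable (R : Type*) [CommRing R] {V : Type*} [DecidableEq V]

/-- `NONE_A = ∏_{w ∈ A} (1 - X_w)` (no variable of `A` is set). [cite: Burgisser2000, proof of Prop. 2.20] -/
def nonePoly (A : Finset V) : MvPolynomial V R := ∏ w ∈ A, (1 - X w)

/-- `EX1_A = ∑_{v ∈ A} X_v ∏_{w ∈ A ∖ v} (1 - X_w)` (exactly one variable of `A` is set). [cite: Burgisser2000, proof of Prop. 2.20] -/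
def ex1Poly (A : Finset V) : MvPolynomial V R := ∑ v ∈ A, X v * ∏ w ∈ A.erase v, (1 - X w)

/-- `AM1_A = EX1_A + NONE_A` (at most one variable of `A` is set). [cite: Burgisser2000, proof of Prop. 2.20] -/
def am1Poly (A : Finset V) : MvPolynomial V R := ex1Poly R A + nonePoly R A

variable {R}

omit [DecidableEq V] in
/-- Boolean value of `1 - X_w`. [cite: Burgisser2000, proof of Prop. 2.20] -/
theorem eval_boolPoint_one_sub_X (e : V → Bool) (w : V) :
    eval (boolPoint R e) (1 - X w : MvPolynomial V R) = if e w = false then 1 else 0 := by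
  simp only [map_sub, map_one, eval_X, boolPoint]
  cases e w <;> simp

omit [DecidableEq V] in
/-- Boolean value of `NONE_A`. [cite: Burgisser2000, proof of Prop. 2.20] -/
theorem eval_boolPoint_nonePoly (e : V → Bool) (A : Finset V) :
    eval (boolPoint R e) (nonePoly R A) = if (∀ w ∈ A, e w = false) then 1 else 0 := by
  simp only [nonePoly, map_prod, eval_boolPoint_one_sub_X]
  exact Finset.prod_boole

/-- The set of "exactly-one witnesses" is the set of set variables when that set is a singleton,
and empty otherwise. [folklore] -/
theorem filter_exactlyOne_eq (e : V → Bool) (A : Finset V) :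
    (A.filter fun v => e v = true ∧ ∀ w ∈ A.erase v, e w = false) =
      if (A.filter fun v => e v = true).card = 1 then A.filter (fun v => e v = true) else ∅ := by
  have key : ∀ v, (v ∈ A ∧ (e v = true ∧ ∀ w ∈ A.erase v, e w = false)) ↔
      A.filter (fun v => e v = true) = {v} := by
    intro v
    constructor
    · rintro ⟨hvA, hv, hw⟩
      ext w
      simp only [Finset.mem_filter, Finset.mem_singleton]
      constructor
      · rintro ⟨hwA, hw'⟩
        by_contra hne
        have := hw w (Finset.mem_erase.2 ⟨hne, hwA⟩)
        rw [this] at hw'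
        exact Bool.false_ne_true hw'
      · rintro rfl
        exact ⟨hvA, hv⟩
    · intro h
      have hv : v ∈ A.filter (fun v => e v = true) := h ▸ Finset.mem_singleton_self v
      refine ⟨(Finset.mem_filter.1 hv).1, (Finset.mem_filter.1 hv).2, fun w hw => ?_⟩
      obtain ⟨hne, hwA⟩ := Finset.mem_erase.1 hw
      cases hew : e w
      · rfl
      · have : w ∈ A.filter (fun v => e v = true) := Finset.mem_filter.2 ⟨hwA, hew⟩
        rw [h] at this
        exact absurd (Finset.mem_singleton.1 this) hne
  ext v
  rw [Finset.mem_filter, key]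
  split_ifs with h1
  · constructor
    · intro h; rw [h]; exact Finset.mem_singleton_self v
    · intro hv
      obtain ⟨a, ha⟩ := Finset.card_eq_one.1 h1
      rw [ha] at hv ⊢
      rw [Finset.mem_singleton.1 hv]
  · simp only [Finset.notMem_empty, iff_false]
    intro h
    rw [h, Finset.card_singleton] at h1
    exact h1 rfl

/-- Boolean value of `EX1_A`. [cite: Burgisser2000, proof of Prop. 2.20] -/
theorem eval_boolPoint_ex1Poly (e : V → Bool) (A : Finset V) :
    eval (boolPoint R e) (ex1Poly R A) =
      if (A.filter fun v => e v = true).card = 1 then 1 else 0 := by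
  have h1 : eval (boolPoint R e) (ex1Poly R A) =
      ∑ v ∈ A, (if (e v = true ∧ ∀ w ∈ A.erase v, e w = false) then (1 : R) else 0) := by
    simp only [ex1Poly, map_sum, map_mul, map_prod, eval_X, eval_boolPoint_one_sub_X,
      Finset.prod_boole]
    refine Finset.sum_congr rfl fun v _ => ?_
    simp only [boolPoint]
    rw [ite_zero_mul_ite_zero, mul_one]
  rw [h1, Finset.sum_boole, filter_exactlyOne_eq]
  split_ifs with h
  · simp [h]
  · simp

/-- Boolean value of `AM1_A`. [cite: Burgisser2000, proof of Prop. 2.20] -/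
theorem eval_boolPoint_am1Poly (e : V → Bool) (A : Finset V) :
    eval (boolPoint R e) (am1Poly R A) =
      if (A.filter fun v => e v = true).card ≤ 1 then 1 else 0 := by
  rw [am1Poly, map_add, eval_boolPoint_ex1Poly, eval_boolPoint_nonePoly]
  have hiff : (∀ w ∈ A, e w = false) ↔ (A.filter fun v => e v = true).card = 0 := by
    rw [Finset.card_eq_zero, Finset.filter_eq_empty_iff]
    simp
  simp only [hiff]
  rcases hn : (A.filter fun v => e v = true).card with _ | _ | n
  · simp
  · simp
  · have h1 : n + 1 + 1 ≠ 1 := by omega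
    have h2 : ¬ (n + 1 + 1 ≤ 1) := by omega
    simp [h2]

/-! ### Complexity and degree of the gadgets -/

omit [DecidableEq V] in
/-- `L(1 - X_w) ≤ 2`. [cite: Burgisser2000, Def. 2.1] -/
theorem complexity_one_sub_X_le (w : V) : complexity (1 - X w : MvPolynomial V R) ≤ 2 := by
  have := complexity_one_sub_le (X w : MvPolynomial V R)
  rwa [complexity_X_holds, zero_add] at this

omit [DecidableEq V] in
/-- `L(NONE_A) ≤ 3|A|`. [cite: Burgisser2000, Def. 2.1] -/
theorem complexity_nonePoly_le (A : Finset V) : complexity (nonePoly R A) ≤ 3 * A.card := by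
  refine (complexity_finset_prod_le _ _).trans ?_
  have : ∑ w ∈ A, complexity (1 - X w : MvPolynomial V R) ≤ A.card * 2 :=
    (Finset.sum_le_card_nsmul _ _ 2 fun w _ => complexity_one_sub_X_le w).trans (by simp)
  omega

/-- `L(EX1_A) ≤ 3|A|² + 2|A|`. [cite: Burgisser2000, Def. 2.1] -/
theorem complexity_ex1Poly_le (A : Finset V) :
    complexity (ex1Poly R A) ≤ 3 * A.card ^ 2 + 2 * A.card := by
  refine (complexity_finset_sum_le _ _).trans ?_
  have hterm : ∀ v ∈ A, complexity (X v * ∏ w ∈ A.erase v, (1 - X w) : MvPolynomial V R) ≤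
      3 * A.card + 1 := by
    intro v _
    refine (complexity_mul_le_holds _ _).trans ?_
    rw [complexity_X_holds, zero_add]
    have h := complexity_nonePoly_le (R := R) (A.erase v)
    rw [nonePoly] at h
    have : (A.erase v).card ≤ A.card := Finset.card_erase_le
    omega
  have := Finset.sum_le_card_nsmul _ _ _ hterm
  rw [smul_eq_mul] at this
  nlinarith [this]

/-- `L(AM1_A) ≤ 3|A|² + 5|A| + 1`. [cite: Burgisser2000, Def. 2.1] -/
theorem complexity_am1Poly_le (A : Finset V) :
    complexity (am1Poly R A) ≤ 3 * A.card ^ 2 + 5 * A.card + 1 := by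
  refine (complexity_add_le_holds _ _).trans ?_
  have h1 := complexity_ex1Poly_le (R := R) A
  have h2 := complexity_nonePoly_le (R := R) A
  omega

omit [DecidableEq V] in
/-- `deg (1 - X_w) ≤ 1`. [folklore] -/
theorem totalDegree_one_sub_X_le (w : V) : (1 - X w : MvPolynomial V R).totalDegree ≤ 1 := by
  refine (totalDegree_sub _ _).trans (max_le (by simp) ?_)
  rcases subsingleton_or_nontrivial R with hR | hR
  · have : (X w : MvPolynomial V R) = C (1 : R) * X w := by simp
    rw [this, Subsingleton.elim (1 : R) 0, C_0, zero_mul, totalDegree_zero]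
    exact Nat.zero_le _
  · rw [totalDegree_X]

omit [DecidableEq V] in
/-- `deg NONE_A ≤ |A|`. [folklore] -/
theorem totalDegree_nonePoly_le (A : Finset V) : (nonePoly R A).totalDegree ≤ A.card := by
  refine (totalDegree_finsetProd _ _).trans ?_
  have := Finset.sum_le_card_nsmul _ _ 1 fun w (_ : w ∈ A) => totalDegree_one_sub_X_le (R := R) w
  simpa using this

/-- `deg EX1_A ≤ |A| + 1`. [folklore] -/
theorem totalDegree_ex1Poly_le (A : Finset V) : (ex1Poly R A).totalDegree ≤ A.card + 1 := by
  refine totalDegree_finsetSum_le fun v hv => ?_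
  refine (totalDegree_mul _ _).trans ?_
  have h1 : (X v : MvPolynomial V R).totalDegree ≤ 1 := by
    have := totalDegree_one_sub_X_le (R := R) v
    rcases subsingleton_or_nontrivial R with hR | hR
    · have : (X v : MvPolynomial V R) = C (1 : R) * X v := by simp
      rw [this, Subsingleton.elim (1 : R) 0, C_0, zero_mul, totalDegree_zero]
      exact Nat.zero_le _
    · rw [totalDegree_X]
  have h2 := totalDegree_nonePoly_le (R := R) (A.erase v)
  rw [nonePoly] at h2
  have : (A.erase v).card ≤ A.card := Finset.card_erase_le
  omega

/-- `deg AM1_A ≤ |A| + 1`. [folklore] -/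
theorem totalDegree_am1Poly_le (A : Finset V) : (am1Poly R A).totalDegree ≤ A.card + 1 :=
  (totalDegree_add _ _).trans (max_le (totalDegree_ex1Poly_le A)
    ((totalDegree_nonePoly_le A).trans (Nat.le_succ _)))

end Gadgets

/-! ## Part V — the indicator polynomial of exact covers and `XC_{c,•} ∈ VNP` -/

section Indicator

open MvPolynomial Literature.Computability.AlgebraicComplexity

variable (R : Type*) [CommRing R]

/-- The variables of block `b`. [folklore] -/
def blockVars (m c : ℕ) (b : Fin m) : Finset (Fin m × PowC (m * c) c) :=
  Finset.univ.filter fun v => v.1 = b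

/-- The variables `Y_{b,J}` with `j ∈ J`. [folklore] -/
def colVars (m c : ℕ) (j : Fin (m * c)) : Finset (Fin m × PowC (m * c) c) :=
  Finset.univ.filter fun v => j ∈ v.2.1

/-- **The indicator polynomial of exact covers**: on `{0,1}`-points it is `1` iff exactly one
`Y_{b,J}` is set in every block `b` and every column `j` lies in at most one set `J` of a set
variable; a product of `m + mc` gadgets, hence of polynomial size and degree. [cite: Burgisser2000, Prop. 2.20] -/
def indPoly (m c : ℕ) : MvPolynomial (Fin m × PowC (m * c) c) R :=
  (∏ b, ex1Poly R (blockVars m c b)) * ∏ j, am1Poly R (colVars m c j)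

variable {R}

/-- Boolean values of the indicator polynomial. [cite: Burgisser2000, Prop. 2.20] -/
theorem eval_boolPoint_indPoly (m c : ℕ) (e : Fin m × PowC (m * c) c → Bool) :
    eval (boolPoint R e) (indPoly R m c) =
      if (∀ b, ((blockVars m c b).filter fun v => e v = true).card = 1) ∧
          ∀ j, ((colVars m c j).filter fun v => e v = true).card ≤ 1 then 1 else 0 := by
  rw [indPoly, map_mul, map_prod, map_prod]
  simp only [eval_boolPoint_ex1Poly, eval_boolPoint_am1Poly, Finset.prod_boole,
    ite_zero_mul_ite_zero, mul_one, Finset.mem_univ, true_implies]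

/-- The generating polynomial of the Boolean part, for an arbitrary finite variable type (the
tree's `ValiantCriterion.genPoly` is the case `Fin m`). [cite: Burgisser2000, Prop. 2.20] -/
def genPolyV {V : Type*} [Fintype V] [DecidableEq V] (F : MvPolynomial V R) : MvPolynomial V R :=
  ∑ e : V → Bool, C (eval (boolPoint R e) F) * ∏ v, (if e v then X v else 1)

/-- `genPoly` commutes with renaming along an equivalence onto `Fin N`. [cite: Burgisser2000, Rem. 2.2] -/
theorem genPoly_rename_equiv {V : Type*} [Fintype V] [DecidableEq V] {N : ℕ} (ε : V ≃ Fin N)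
    (F : MvPolynomial V R) :
    ValiantCriterion.genPoly (rename ε F) = rename ε (genPolyV F) := by
  classical
  unfold ValiantCriterion.genPoly genPolyV
  simp only [map_sum, map_mul, rename_C, map_prod]
  refine Fintype.sum_equiv (ε.symm.arrowCongr (Equiv.refl Bool)) _ _ fun e' => ?_
  have hε : (ε.symm.arrowCongr (Equiv.refl Bool)) e' = e' ∘ ε := by
    funext v; simp [Equiv.arrowCongr]
  rw [hε]
  congr 1
  · rw [eval_rename]
    rfl
  · rw [← Fintype.prod_equiv ε (fun v => rename ε (if (e' ∘ ε) v then X v else 1))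
      (fun t => if e' t then X t else 1) (fun v => by
        simp only [Function.comp_apply]
        split_ifs <;> simp)]

/-- The `{0,1}`-indicator vector of the graph of a family `T`. [folklore] -/
def indic {m c : ℕ} (T : Fin m → PowC (m * c) c) : Fin m × PowC (m * c) c → Bool :=
  fun v => decide (T v.1 = v.2)

/-- The support of the indicator vector of `T` is the graph of `T`. [folklore] -/
theorem filter_indic_eq_image {m c : ℕ} (T : Fin m → PowC (m * c) c) :
    (Finset.univ.filter fun v => indic T v = true) =
      Finset.univ.image fun b => (b, T b) := by
  ext ⟨b, J⟩
  simp only [Finset.mem_filter, Finset.mem_univ, true_and, indic, decide_eq_true_eq,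
    Finset.mem_image, Prod.mk.injEq]
  constructor
  · rintro rfl; exact ⟨b, rfl, rfl⟩
  · rintro ⟨b', rfl, h⟩; exact h

/-- In block `b` the indicator vector of `T` selects exactly `Y_{b, T b}`. [folklore] -/
theorem blockVars_filter_indic {m c : ℕ} (T : Fin m → PowC (m * c) c) (b : Fin m) :
    ((blockVars m c b).filter fun v => indic T v = true) = {(b, T b)} := by
  ext ⟨b', J⟩
  simp only [blockVars, Finset.mem_filter, Finset.mem_univ, true_and, indic, decide_eq_true_eq,
    Finset.mem_singleton, Prod.mk.injEq]
  constructor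
  · rintro ⟨rfl, rfl⟩; exact ⟨rfl, rfl⟩
  · rintro ⟨rfl, rfl⟩; exact ⟨rfl, rfl⟩

/-- **`genPoly` of the indicator is the exact-cover polynomial.** [cite: Burgisser2000, Prop. 2.20] -/
theorem genPolyV_indPoly (m c : ℕ) : genPolyV (indPoly R m c) = xcPoly R m c := by
  classical
  unfold genPolyV xcPoly
  -- kill the non-covers, turn the selector monomial into a product over the set variables
  have hmon : ∀ e : Fin m × PowC (m * c) c → Bool,
      (∏ v, (if e v then X v else 1) : MvPolynomial (Fin m × PowC (m * c) c) R) =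
        ∏ v ∈ Finset.univ.filter (fun v => e v = true), X v := by
    intro e
    rw [Finset.prod_filter]
  simp_rw [eval_boolPoint_indPoly, hmon]
  rw [show (∑ e : Fin m × PowC (m * c) c → Bool,
      C (if (∀ b, ((blockVars m c b).filter fun v => e v = true).card = 1) ∧
            ∀ j, ((colVars m c j).filter fun v => e v = true).card ≤ 1 then (1 : R) else 0) *
        ∏ v ∈ Finset.univ.filter (fun v => e v = true), X v) =
      ∑ e ∈ Finset.univ.filter (fun e : Fin m × PowC (m * c) c → Bool =>
        (∀ b, ((blockVars m c b).filter fun v => e v = true).card = 1) ∧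
          ∀ j, ((colVars m c j).filter fun v => e v = true).card ≤ 1),
        ∏ v ∈ Finset.univ.filter (fun v => e v = true), (X v : MvPolynomial _ R) from by
    rw [Finset.sum_filter]
    refine Finset.sum_congr rfl fun e _ => ?_
    split_ifs <;> simp]
  symm
  refine Finset.sum_bij (fun T _ => indic T) ?_ ?_ ?_ ?_
  · -- graphs of admissible families are exact covers
    intro T hT
    have hdisj := (Finset.mem_filter.1 hT).2
    refine Finset.mem_filter.2 ⟨Finset.mem_univ _, fun b => ?_, fun j => ?_⟩
    · rw [blockVars_filter_indic, Finset.card_singleton]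
    · refine Finset.card_le_one.2 fun v hv v' hv' => ?_
      simp only [colVars, Finset.mem_filter, Finset.mem_univ, true_and, indic,
        decide_eq_true_eq] at hv hv'
      obtain ⟨hj, hT1⟩ := hv
      obtain ⟨hj', hT2⟩ := hv'
      have hb : v.1 = v'.1 := by
        by_contra hne
        have := Finset.disjoint_left.1 (hdisj _ _ hne) (hT1 ▸ hj : j ∈ (T v.1).1)
        exact this (hT2 ▸ hj')
      exact Prod.ext hb (by rw [← hT1, ← hT2, hb])
  · -- injective
    intro T hT T' hT' h
    funext b
    have := congrFun h (b, T b)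
    simp only [indic, decide_true] at this
    exact (of_decide_eq_true this.symm).symm
  · -- surjective onto exact covers
    intro e he
    obtain ⟨hg1, hg2⟩ := (Finset.mem_filter.1 he).2
    choose a ha using fun b => Finset.card_eq_one.1 (hg1 b)
    have hmem : ∀ b, a b ∈ (blockVars m c b).filter fun v => e v = true := fun b => by
      rw [ha b]; exact Finset.mem_singleton_self _
    have ha1 : ∀ b, (a b).1 = b ∧ e (a b) = true := fun b => by
      have := Finset.mem_filter.1 (hmem b)
      exact ⟨(Finset.mem_filter.1 this.1).2, this.2⟩
    have huniq : ∀ b v, v.1 = b → e v = true → v = a b := fun b v h1 h2 => by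
      have : v ∈ (blockVars m c b).filter fun v => e v = true :=
        Finset.mem_filter.2 ⟨Finset.mem_filter.2 ⟨Finset.mem_univ _, h1⟩, h2⟩
      rw [ha b] at this
      exact Finset.mem_singleton.1 this
    refine ⟨fun b => (a b).2, Finset.mem_filter.2 ⟨Finset.mem_univ _, fun b b' hbb' => ?_⟩, ?_⟩
    · rw [Finset.disjoint_left]
      intro j hj hj'
      have h1 : a b ∈ (colVars m c j).filter fun v => e v = true :=
        Finset.mem_filter.2 ⟨Finset.mem_filter.2 ⟨Finset.mem_univ _, hj⟩, (ha1 b).2⟩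
      have h2 : a b' ∈ (colVars m c j).filter fun v => e v = true :=
        Finset.mem_filter.2 ⟨Finset.mem_filter.2 ⟨Finset.mem_univ _, hj'⟩, (ha1 b').2⟩
      have := Finset.card_le_one.1 (hg2 j) _ h1 _ h2
      exact hbb' (by rw [← (ha1 b).1, ← (ha1 b').1, this])
    · funext ⟨b, J⟩
      simp only [indic]
      cases h : e (b, J)
      · rw [decide_eq_false_iff_not]
        intro hJ
        have : (b, J) = a b := Prod.ext (ha1 b).1.symm hJ.symm
        rw [this, (ha1 b).2] at h
        exact Bool.noConfusion h
      · rw [decide_eq_true_iff]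
        have := huniq b (b, J) rfl h
        rw [← this]
  · -- summands agree
    intro T hT
    rw [filter_indic_eq_image, Finset.prod_image fun b _ b' _ h => (Prod.mk.inj h).1]

end Indicator

end Summit.ValiantsHypothesis.ValiantsHypothesis.Theorems.ExactCoverIndicator
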